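import Mathlib.Analysis.SpecialFunctions.Complex.CircleAddChar
import Mathlib.Analysis.SpecialFunctions.Pow.Real
import Literature.MathematicalPhysics.QuantumLattice.FinDimSpectrum
import Literature.MathematicalPhysics.QuantumLattice.SpinSystem
import Literature.MathematicalPhysics.QuantumLattice.LatticeTori
import Literature.MathematicalPhysics.QuantumLattice.LocalDynamics
import Literature.MathematicalPhysics.QuantumLattice.LTQO
import HarnessLib

-- provenance: harness21/H21/H21/Prelude/QLatticeAQFT/SpinLiquid.lean @ 62d5d39 (interim HEAD d8f2665); M5 mechanical rewrite
-- `Literature.Prelude.StatMech.TorusFourier` (whose phase convention `ZMod.stdAddChar` we follow) and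
-- `Mathlib.Analysis.Fourier.ZMod` are deliberately *not* imported: only the character
-- `ZMod.stdAddChar` (from `CircleAddChar`) is used; `CorrelationDecay`, `ThermodynamicLimit`,
-- `LatticeGraph`, `SpinOperators` arrive transitively through `LatticeTori` / `LTQO`.

/-!
# Quantum spin liquids: the H21 working definition (trunk QLatticeAQFT, item Q14; outline Q-D7)

Notions `spin_liquid_definition`, `long_range_order`. **There is no canonical definition of a
quantum spin liquid in print**; the physics literature (Savary–Balents, *Rep. Prog. Phys.* **80**
(2017) 016502, §2; Knolle–Moessner, *Ann. Rev. Cond. Mat. Phys.* **10** (2019) 451, §1–2)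
characterises it negatively ("a Mott insulator with an odd number of half-odd-integer spins per
unit cell whose ground state breaks no symmetry and has no local order parameter down to `T = 0`")
plus positively by long-range entanglement (gapped topological order, or gapless algebraic
correlations). This file gives the **H21 working definition** consumed by `hubbard.S03`
(kagome Heisenberg antiferromagnet) and `hubbard.S24`, following outline decision Q-D7,
candidate (a): *entirely in finite volume*, on the decorated discrete tori
`StatMech.TorusSite d L × κ` (`(ℤ/Lℤ)^d` times a finite unit cell `κ`; Bravais lattices
`κ = Unit`, kagome `κ = Fin 3`, so that `KagomeTorusVertex L = TorusSite 2 L × Fin 3` of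
`Literature.Prelude.QLatticeAQFT.KagomeLattice` is literally an instance), for a *state family*
`ω : ∀ L, Op (TorusSite d L × κ) q →ₗ[ℂ] ℂ` (typically `fun L => (H L).groundStateFunctional`).
No infinite-volume states are used.

## Contents

* `pushOp f A`: an observable on sites `Λ₀` pushed forward along a site map `f : Λ₀ → Λ`
  (entrywise, as `wrapTerm` in `LocalDynamics`); `LocalOrderParameter d κ q`: an observable on a
  box `box d r × κ` of `ℤ^d × κ`; `orderParamAt O x = O_x`, its translate placed at the Bravais
  site `x` of the torus; `torusTranslate v`, the torus translations as algebra automorphisms.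
* `connectedCorr ωL O x y = ω(O_xᴴ O_y) - ω(O_xᴴ) ω(O_y)` and the **structure factor**
  `structureFactor ωL O k = L^{-2d} Σ_{x y} e^{2πi k·(x-y)/L} ⟨O_x ; O_y⟩` (phase = Mathlib's
  `ZMod.stdAddChar`, the character of `StatMech.torusFourier`);
  `HasNoLongRangeOrder ω O`: `S_L(k_L) → 0` for every sequence of ordering vectors `k_L`;
  `not_hasTorusLRO_of_hasNoLongRangeOrder` links `k = 0` to the §0 convention `HasTorusLRO`.
* `IsSymmetricFamily ω`: invariance under torus translations and global `SU(2)` rotations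
  (`globalRotation`). **Point-group (lattice rotation/reflection) symmetry is deliberately not
  required** (stated simplification of Q-D7).
* `groundClusterProj H m`: the spectral projection onto the `m` lowest eigenvectors;
  `IsGappedTopologicalPhase H m`: uniform cluster gap above `m` quasi-degenerate ground states
  (`Matrix.HasClusterGap`, width `w L → 0`) whose projector is locally indistinguishable
  (LTQO inequality with `ltqoConst`, rate `Δ' L → 0`) on cell balls of radius `r` with
  `4 r < L` (BHM linear cutoff, see the design notes); `HasAlgebraicDecay ω O`: power-law
  *upper* bound on `⟨O_0 ; O_x⟩` in the torus norm.
* `IsSpinLiquid n ω H`, `IsGappedSpinLiquid n ω H`, `IsGaplessSpinLiquid n ω`, and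
  `isSpinLiquid_iff`.

## Sources

* L. Savary, L. Balents, *Quantum spin liquids: a review*, Rep. Prog. Phys. **80** (2017)
  016502, §2 ("What is a quantum spin liquid?"), §3.1 (structure factor, absence of Bragg peaks),
  §4 (gapped `ℤ₂` / topological order), §5 (gapless `U(1)` and algebraic spin liquids).
* J. Knolle, R. Moessner, *A field guide to spin liquids*, Ann. Rev. Cond. Mat. Phys. **10**
  (2019) 451–472, §1–2.
* S. Michalakis, J. P. Zwolak, Comm. Math. Phys. **322** (2013) §2 (cluster gap, LTQO).
* S. Bravyi, M. B. Hastings, S. Michalakis, J. Math. Phys. **51** (2010) 093512, §2 (TQO-1/2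
  with the linear cutoff `L*`).
* M. B. Hastings, *Lieb–Schultz–Mattis in higher dimensions*, PRB **69** (2004) 104431
  (half-odd-integer spin per unit cell ⇒ no unique gapped symmetric ground state).

## Mathlib / H21 search and design notes

* Mathlib: `rg -i "spin liquid|structure factor|order parameter|topological order"` finds nothing.
  Used: `ZMod.stdAddChar` (`Mathlib.Analysis.SpecialFunctions.Complex.CircleAddChar`),
  `Matrix.IsHermitian.eigenvectorBasis/eigenvalues₀` (sorted decreasingly,
  `eigenvalues₀_antitone`), `Fintype.equivOfCardEq`, `Submodule.span`, `Filter.Tendsto`,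
  `Real.rpow`, `Matrix.reindexAlgEquiv` (through `reindexOp`). H21: `Op`, `localOp`,
  `IsSupportedOn`, `reindexOp`, `globalRotation` (Q3), `projMatrix`, `Matrix.HasClusterGap`,
  `Matrix.groundStateFunctional` (Q1), `torusNorm`, `HasTorusLRO` (Q5a), `cellBall`, `ltqoConst`,
  `IsDecaying` (Q11), `box`, `Torus.proj`, `TorusSite` (G02).
* **Connected correlations.** The outline's structure factor uses the full correlator
  `ω(O_xᴴ O_y)`; with it `∀ O, HasNoLongRangeOrder ω O` is *false* for every normalised family
  (take `O = 1`: `S_L(0) = ω(1) = 1`), which would make `IsSpinLiquid` vacuous. We therefore use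
  the connected (truncated) correlator `⟨O_x ; O_y⟩ = ω(O_xᴴ O_y) - ω(O_xᴴ) ω(O_y)`
  (`connectedCorr`), as Savary–Balents §3.1 do; for order parameters with `ω(O_x) = 0` (Néel,
  dimer, chiral order in an `SU(2)`- and translation-invariant state) nothing changes.
* **`Fintype (ZMod L)` needs `NeZero L`.** Single-volume notions take `[NeZero L]`; family
  predicates quantify `∀ L [NeZero L]`, and the sequence in `HasNoLongRangeOrder` is indexed by
  the side `L + 1` (shifting the index does not change a limit along `atTop`), exactly as
  `hasTorusLRO_iff` in `LatticeTori`; `orderParamCorrFamily` (feeding `HasTorusLRO`, whose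
  argument is indexed by all `L : ℕ`) is defined by pattern matching with junk value `0` at
  `L = 0`.
* `orderParamAt O x` is meaningful when the box fits into the torus, `2 r + 1 ≤ L`; otherwise
  the placement map `box d r × κ → TorusSite d L × κ` is not injective and the value is a
  documented junk observable (still supported on the image).
* `groundClusterProj H m` is `0` for non-Hermitian `H` (junk); for `card < m` it projects onto
  everything. Under `HasClusterGap (H L) m w γ` it is the spectral projection of the cluster.
* **Cutoff `4 r < L` in `IsGappedTopologicalPhase`** (deviation from the outline's `2 r < L`,
  which is off by one and makes the predicate *unsatisfiable* for `m ≥ 2`: for odd `L = 2r + 1`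
  the sup-norm ball `cellBall x r` is the whole torus, every `O` is supported on it, and a
  rank-`m` projector `P` is distinguishable by `O = |u⟩⟨v|`, `u ⊥ v ∈ range P`, forcing
  `1 ≤ Δ' L`). We use the Bravyi–Hastings–Michalakis linear cutoff (TQO-1 for sets of linear
  size `≤ L* ∝ L`, J. Math. Phys. **51** (2010) 093512, §2): balls of diameter `2r + 1 ≤ L/2`,
  i.e. `4 r < L`, so that the complement of the ball has linear size `≥ L/2 → ∞` and a rate
  `Δ' L → 0` indexed by the volume is meaningful also away from commuting-projector fixed points
  (where dressed logical operators have a finite width). Toric-code-type models satisfy the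
  clause with `Δ' = 0`.
* `HasAlgebraicDecay` is an *upper* bound only (as in the outline): it does **not** exclude
  short-range-correlated states (any family with finite-range connected correlations satisfies
  it), so `IsGaplessSpinLiquid` alone does not certify gaplessness; consumers pair it with the
  absence of a gapped phase when needed. Documented limitation of the working definition.
* `LocalOrderParameter` is a two-field structure (radius + observable) rather than a bare
  `Σ`-type, per Mathlib bundling conventions; `⟨r, A⟩` still works.
-/

noncomputable section

open Matrix Complex Finset Filter ZMod
open scoped Matrix.Norms.L2Operator Topology

namespace Literature.MathematicalPhysics.QuantumLattice

open Literature.Probability.LatticeModels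

/-! ### Pushing observables along site maps; local order parameters -/

section Push

variable {Λ₀ Λ : Type*} [Fintype Λ₀] [DecidableEq Λ] {q : ℕ}

open Classical in
/-- The observable `A ∈ 𝔄_{Λ₀}` pushed forward along a site map `f : Λ₀ → Λ`: entrywise
`⟨σ| pushOp f A |τ⟩ = A (σ ∘ f) (τ ∘ f)` if `σ = τ` off `range f`, else `0`. For injective `f`
this is `A` relabelled to `f(Λ₀)` and tensored with the identity elsewhere (`localOp` on the
image, `isSupportedOn_pushOp`); for non-injective `f` it is a junk observable (still supported
on the image). Same construction as `wrapTerm` (`LocalDynamics`), including the classical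
decidability of the off-image condition (`Λ` need not be finite). Bratteli–Robinson II §6.2.1
(covariance of local algebras). [folklore] -/
def pushOp (f : Λ₀ → Λ) (A : Op Λ₀ q) : Op Λ q :=
  of fun σ τ => if (∀ y, y ∉ univ.image f → σ y = τ y) then A (σ ∘ f) (τ ∘ f) else 0

/-- A pushed-forward observable is supported on the image of the site map (an elementary property
of this file's `pushOp`; covariance of local algebras as in Bratteli–Robinson II §6.2.1).
DISCHARGED in the tree by `isSupportedOn_pushOp_holds` (`QuantumLattice/SpinLiquidProofs.lean`).
[folklore] -/
def isSupportedOn_pushOp : Prop :=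
  ∀ [Fintype Λ] (f : Λ₀ → Λ) (A : Op Λ₀ q),
    IsSupportedOn (pushOp f A) (univ.image f)

/-- Pushing forward commutes with the adjoint. Bratteli–Robinson II §6.2.1. [folklore] -/
theorem pushOp_conjTranspose (f : Λ₀ → Λ) (A : Op Λ₀ q) :
    pushOp f Aᴴ = (pushOp f A)ᴴ := by
  classical
  ext σ τ
  simp only [pushOp, of_apply, conjTranspose_apply]
  have h : (∀ y, y ∉ univ.image f → σ y = τ y) ↔ (∀ y, y ∉ univ.image f → τ y = σ y) :=
    forall_congr' fun y => imp_congr_right fun _ => eq_comm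
  rw [if_congr h rfl rfl]
  split_ifs <;> simp

end Push

variable {d : ℕ} {κ : Type*} [Fintype κ] [DecidableEq κ] {q : ℕ}

/-- A **local order parameter** on `ℤ^d × κ` with local dimension `q`: an observable `op`
living on the decorated box `box d radius × κ` (`box d r = [-r, r]^d`), to be translated to
every Bravais site of a torus (`orderParamAt`). Examples: a site spin `S^z_0` (Néel order, with
ordering vector `k = (π, π)`), a bond energy `𝐒_0 · 𝐒_{e₁}` (valence-bond-crystal order), a
scalar chirality `𝐒_0 · (𝐒_{e₁} × 𝐒_{e₂})` (chiral order). Savary–Balents (2017) §2, §3.1;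
H21 working definition (no canonical definition in print). [cite: SavaryBalents2017] -/
structure LocalOrderParameter (d : ℕ) (κ : Type*) (q : ℕ) where
  /-- The radius `r` of the supporting box `[-r, r]^d`. -/
  radius : ℕ
  /-- The observable on the decorated box `box d radius × κ`. -/
  op : Op (↥(box d radius) × κ) q

/-- The translate `O_x ∈ 𝔄_{(ℤ/Lℤ)^d × κ}` of the local order parameter `O` to the Bravais site
`x` of the torus: `O.op` pushed forward along `(b, k) ↦ (proj_L b + x, k)`
(`Torus.proj`, `pushOp`). Meaningful when the box fits, `2 · radius + 1 ≤ L` (the placement map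
is then injective); otherwise a documented junk observable. Savary–Balents (2017) §3.1;
H21 working definition. [cite: SavaryBalents2017] -/
def orderParamAt (O : LocalOrderParameter d κ q) {L : ℕ} (x : TorusSite d L) :
    Op (TorusSite d L × κ) q :=
  pushOp (fun p : ↥(box d O.radius) × κ => (Torus.proj L (p.1 : Site d) + x, p.2)) O.op

/-- The torus translation by `v ∈ (ℤ/Lℤ)^d` acting on observables of the decorated torus,
`A ↦ τ_v A`, as a `ℂ`-algebra automorphism: `reindexOp` along `(y, k) ↦ (y + v, k)` on the
Bravais factor. Bratteli–Robinson II §6.2.1 (covariance); Savary–Balents (2017) §2. [cite: SavaryBalents2017] -/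
def torusTranslate {L : ℕ} [NeZero L] (v : TorusSite d L) :
    Op (TorusSite d L × κ) q ≃ₐ[ℂ] Op (TorusSite d L × κ) q :=
  reindexOp (Equiv.prodCongr (Equiv.addRight v) (Equiv.refl κ))

/-- `O_x` is supported on the translated decorated box `(proj_L (box d r) + x) × κ`.
Bratteli–Robinson II §6.2.1. [folklore] -/
def isSupportedOn_orderParamAt : Prop :=
  ∀ {L : ℕ} [NeZero L] (O : LocalOrderParameter d κ q) (x : TorusSite d L),
    IsSupportedOn (orderParamAt O x)
      (univ.image fun p : ↥(box d O.radius) × κ => (Torus.proj L (p.1 : Site d) + x, p.2))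

/- interim proof relied on results that are now named facts (D-0014); demoted to a fact by the M5 import, proof preserved:
:=
  isSupportedOn_pushOp _ _
-/

/-- Translation covariance of the placed order parameter: `τ_v O_x = O_{x+v}` (an elementary
property of this file's `torusTranslate` / `orderParamAt`; covariance of local algebras as in
Bratteli–Robinson II §6.2.1; not yet discharged in the tree). [folklore] -/
def torusTranslate_orderParamAt : Prop :=
  ∀ {L : ℕ} [NeZero L] (O : LocalOrderParameter d κ q) (v x : TorusSite d L),
    torusTranslate v (orderParamAt O x) = orderParamAt O (x + v)

/-! ### Connected correlations, the structure factor, absence of long-range order -/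

/-- The connected (truncated) two-point function of the local order parameter `O` in the
functional `ωL` on the torus of side `L`:
`⟨O_x ; O_y⟩ = ω(O_xᴴ O_y) - ω(O_xᴴ) ω(O_y)`. Savary–Balents (2017) §3.1 (spin–spin
correlations entering the structure factor); H21 working definition (see the module docstring
for why the connected correlator is used). [cite: SavaryBalents2017] -/
def connectedCorr {L : ℕ} [NeZero L] (ωL : Op (TorusSite d L × κ) q →ₗ[ℂ] ℂ)
    (O : LocalOrderParameter d κ q) (x y : TorusSite d L) : ℂ :=
  ωL ((orderParamAt O x)ᴴ * orderParamAt O y) - ωL (orderParamAt O x)ᴴ * ωL (orderParamAt O y)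

/-- The (normalised, static) **structure factor** of the order parameter `O` in `ωL` at the
ordering vector `k ∈ (ℤ/Lℤ)^d` (momentum `2π k / L`):
`S_L(k) = L^{-2d} Σ_{x, y ∈ (ℤ/Lℤ)^d} e^{2πi k·(x - y)/L} ⟨O_x ; O_y⟩`, the character being
Mathlib's `ZMod.stdAddChar` as in `StatMech.torusFourier` (whose kernel `e^{-2πi k·x/L}` this is
in the relative coordinate `y - x`). Long-range order at `k` means `liminf_L S_L(k) > 0` (a Bragg
peak); e.g. `k = 0` ferro-, `k_i = L/2` Néel order. Savary–Balents (2017) §3.1;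
Friedli–Velenik (2017) §10.4; H21 working definition. [cite: SavaryBalents2017] -/
def structureFactor {L : ℕ} [NeZero L] (ωL : Op (TorusSite d L × κ) q →ₗ[ℂ] ℂ)
    (O : LocalOrderParameter d κ q) (k : TorusSite d L) : ℂ :=
  (((L : ℂ) ^ d)⁻¹) ^ 2 * ∑ x : TorusSite d L, ∑ y : TorusSite d L,
    (∏ i, (stdAddChar (k i * (x i - y i)) : ℂ)) * connectedCorr ωL O x y

/-- **Absence of long-range order** for the local order parameter `O` in the state family `ω`:
for *every* sequence of ordering vectors `k_L ∈ (ℤ/Lℤ)^d` the structure factor tends to zero,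
`S_L(k_L) → 0` as `L → ∞` (no Bragg peak anywhere: neither Néel, nor spiral, nor valence-bond,
nor chiral order, by the choice of `O` and `k`). The sequence is indexed by the side `L + 1`
(`Fintype (ZMod L)` needs `L ≠ 0`; the shift does not affect the limit). Savary–Balents (2017)
§2, §3.1; Knolle–Moessner (2019) §1; H21 working definition (no canonical definition in
print). [cite: SavaryBalents2017] -/
def HasNoLongRangeOrder (ω : ∀ L, Op (TorusSite d L × κ) q →ₗ[ℂ] ℂ)
    (O : LocalOrderParameter d κ q) : Prop :=
  ∀ k : (L : ℕ) → TorusSite d L,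
    Tendsto (fun L : ℕ => ‖structureFactor (ω (L + 1)) O (k (L + 1))‖) atTop (𝓝 0)

/-- The family of real parts of the connected two-point functions
`G L x y = re ⟨O_x ; O_y⟩_{ω L}`, indexed by *all* sides `L : ℕ` as required by the §0
long-range-order convention `HasTorusLRO`; **junk value** `0` at `L = 0` (where the torus type is
infinite). Friedli–Velenik (2017) §3.7.2; H21 working definition. [cite: FriedliVelenik2017] -/
def orderParamCorrFamily (ω : ∀ L, Op (TorusSite d L × κ) q →ₗ[ℂ] ℂ)
    (O : LocalOrderParameter d κ q) : (L : ℕ) → TorusSite d L → TorusSite d L → ℝ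
  | 0 => fun _ _ => 0
  | L + 1 => fun x y => (connectedCorr (ω (L + 1)) O x y).re

/-- At `k = 0` the structure factor is the volume-averaged double sum of the §0 convention:
`S_L(0) = L^{-2d} Σ_{x y} ⟨O_x ; O_y⟩`. Friedli–Velenik (2017) §3.7.2, eq. (3.41). [cite: FriedliVelenik2017] -/
theorem structureFactor_zero {L : ℕ} [NeZero L] (ωL : Op (TorusSite d L × κ) q →ₗ[ℂ] ℂ)
    (O : LocalOrderParameter d κ q) :
    structureFactor ωL O 0 =
      (∑ x : TorusSite d L, ∑ y : TorusSite d L, connectedCorr ωL O x y) / ((L : ℂ) ^ d) ^ 2 := by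
  simp [structureFactor, div_eq_inv_mul]

/-- Absence of long-range order in the sense of `HasNoLongRangeOrder` (at `k = 0`) excludes
long-range order in the sense of the outline's §0 convention
(`HasTorusLRO`, i.e. `0 < liminf_L L^{-2d} Σ_{x y} re ⟨O_x ; O_y⟩`, `hasTorusLRO_iff`).
Friedli–Velenik (2017) §3.7.2; Savary–Balents (2017) §3.1. [cite: FriedliVelenik2017] -/
def not_hasTorusLRO_of_hasNoLongRangeOrder : Prop :=
  ∀ {ω : ∀ L, Op (TorusSite d L × κ) q →ₗ[ℂ] ℂ} {O : LocalOrderParameter d κ q} (h : HasNoLongRangeOrder ω O),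
    ¬ HasTorusLRO (orderParamCorrFamily ω O)

/-! ### Symmetric state families -/

/-- The state family `ω` (local dimension `n + 1`, i.e. spin `n/2`) is **symmetric**: on every
torus it is invariant under all torus translations `τ_v` (`torusTranslate`) and under the global
`SU(2)` spin rotations `A ↦ U(θ) A U(θ)ᴴ` (`globalRotation`). **Point-group (lattice rotation and
reflection) and time-reversal symmetry are deliberately not required** — a stated simplification
of the "breaks no symmetry" clause of Savary–Balents (2017) §2 / Knolle–Moessner (2019) §1;
H21 working definition (no canonical definition in print). The spin label `n` is implicit
(determined by the type of `ω`). [cite: SavaryBalents2017] -/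
def IsSymmetricFamily {n : ℕ} (ω : ∀ L, Op (TorusSite d L × κ) (n + 1) →ₗ[ℂ] ℂ) : Prop :=
  ∀ (L : ℕ) [NeZero L],
    (∀ (v : TorusSite d L) (A : Op (TorusSite d L × κ) (n + 1)), ω L (torusTranslate v A) = ω L A) ∧
    ∀ (θ : Fin 3 → ℝ) (A : Op (TorusSite d L × κ) (n + 1)),
      ω L (globalRotation n θ * A * (globalRotation n θ)ᴴ) = ω L A

/-! ### Gapped topological phases and algebraic decay -/

section Cluster

variable {n : Type*} [Fintype n] [DecidableEq n]

open Classical in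
/-- The **ground-cluster projection**: the orthogonal projection (as a matrix, `projMatrix`) onto
the span of the eigenvectors of the Hermitian matrix `H` belonging to its `m` lowest eigenvalues
counted with multiplicity — the last `m` indices of Mathlib's decreasingly sorted
`IsHermitian.eigenvalues₀`, transported to `IsHermitian.eigenvectorBasis` along
`Fintype.equivOfCardEq`. Under `H.HasClusterGap m w γ` this is the spectral projection of the
low-energy cluster `[E₀, E₀ + w]`. **Junk values:** `0` if `H` is not Hermitian; the identity if
`card n ≤ m`; for degenerate eigenvalues straddling the cut the choice inside the eigenspace is
Mathlib's. Michalakis–Zwolak (2013) §2 (the projection `P₀` onto the ground cluster);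
Tasaki (2020) App. A.2. [cite: MichalakisZwolak2013] -/
def groundClusterProj (H : Matrix n n ℂ) (m : ℕ) : Matrix n n ℂ :=
  if hH : H.IsHermitian then
    projMatrix (Submodule.span ℂ (Set.range fun
      j : {j : Fin (Fintype.card n) // Fintype.card n ≤ (j : ℕ) + m} =>
        hH.eigenvectorBasis (Fintype.equivOfCardEq (Fintype.card_fin _) j.1)))
  else 0

/-- The ground-cluster projection is Hermitian. Tasaki (2020) App. A.2. [cite: Tasaki2020] -/
theorem groundClusterProj_isHermitian (H : Matrix n n ℂ) (m : ℕ) :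
    (groundClusterProj H m).IsHermitian := by
  unfold groundClusterProj
  split_ifs
  · exact projMatrix_isHermitian _
  · exact isHermitian_zero

/-- The ground-cluster projection is idempotent. Tasaki (2020) App. A.2. [cite: Tasaki2020] -/
theorem isIdempotentElem_groundClusterProj (H : Matrix n n ℂ) (m : ℕ) :
    IsIdempotentElem (groundClusterProj H m) := by
  unfold groundClusterProj
  split_ifs
  · exact projMatrix_mul_self _
  · exact IsIdempotentElem.zero

/-- The ground-cluster projection commutes with the Hamiltonian (it is a spectral projection).
Michalakis–Zwolak (2013) §2. [cite: MichalakisZwolak2013] -/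
def groundClusterProj_commute : Prop :=
  ∀ (H : Matrix n n ℂ) (m : ℕ),
    Commute (groundClusterProj H m) H

/-- Under a cluster gap of width `0` with `m` states the ground cluster is the ground space:
`groundClusterProj H m = groundProj H`. Michalakis–Zwolak (2013) §2. [cite: MichalakisZwolak2013] -/
def groundClusterProj_eq_groundProj : Prop :=
  ∀ {H : Matrix n n ℂ} {m : ℕ} {γ : ℝ} (h : H.HasClusterGap m 0 γ),
    groundClusterProj H m = H.groundProj

end Cluster

/-- The Hamiltonian family `H L` on the decorated tori `(ℤ/Lℤ)^d × κ` is in a **gapped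
topological phase with `m` ground states**: there are a uniform gap `γ > 0`, a window width
`w L → 0` and an indistinguishability rate `Δ' L → 0` (`IsDecaying`) such that on every torus
(i) `H L` has exactly `m` eigenvalues in `[E₀, E₀ + w L]` and all others `≥ E₀ + w L + γ`
(`Matrix.HasClusterGap`), and (ii) the ground-cluster projection `P = groundClusterProj (H L) m`
is locally indistinguishable: `‖P O P - c(O) P‖ ≤ ‖O‖ Δ' L` (`c(O) = tr (P O) / tr P`,
`ltqoConst`) for every observable `O` supported in a cell ball `cellBall x r` of linear size at
most half the torus, `4 r < L` (BHM linear cutoff `L* ∝ L`; the outline's `2 r < L` is off by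
one and unsatisfiable for `m ≥ 2`, since for `L = 2r + 1` the ball is the whole torus — see the
module docstring). Topological degeneracy `2 ≤ m` is imposed by the consumer
(`IsGappedSpinLiquid`).
Michalakis–Zwolak (2013) §2 (cluster gap, LTQO); Bravyi–Hastings–Michalakis (2010) (TQO-1/2);
Savary–Balents (2017) §4; H21 working definition (no canonical definition in print). [cite: MichalakisZwolak2013] -/
def IsGappedTopologicalPhase (H : ∀ L, Op (TorusSite d L × κ) q) (m : ℕ) : Prop :=
  ∃ γ : ℝ, 0 < γ ∧ ∃ w Δ' : ℕ → ℝ, IsDecaying w ∧ IsDecaying Δ' ∧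
    ∀ (L : ℕ) [NeZero L], (H L).HasClusterGap m (w L) γ ∧
      ∀ (x : TorusSite d L) (r : ℕ) (O : Op (TorusSite d L × κ) q), 4 * r < L →
        IsSupportedOn O (cellBall x r) →
          ‖groundClusterProj (H L) m * O * groundClusterProj (H L) m -
              ltqoConst (groundClusterProj (H L) m) O • groundClusterProj (H L) m‖ ≤
            ‖O‖ * Δ' L

/-- **Algebraic (power-law) decay** of the correlations of the order parameter `O` in the state
family `ω`, uniformly in the volume: there are `C` and `η > 0` with
`‖⟨O_0 ; O_x⟩_{ω L}‖ ≤ C (‖x‖_𝕋 + 1)^{-η}` for all `L ≥ 1` and `x ∈ (ℤ/Lℤ)^d`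
(`torusNorm`, the periodic sup norm; `Real.rpow`). The hallmark of gapless (`U(1)`, Dirac,
spinon-Fermi-surface) spin liquids. **Caveat:** this is an *upper* bound only, hence it does
not exclude short-range-correlated (e.g. trivially gapped, exponentially clustering) states; a
matching power-law *lower* bound is not part of the working definition (`0 < C` is not required
either: a negative `C` makes the bound unsatisfiable anyway). Savary–Balents (2017) §5;
Knolle–Moessner (2019) §2; H21 working definition (no canonical definition in print). [cite: SavaryBalents2017] -/
def HasAlgebraicDecay (ω : ∀ L, Op (TorusSite d L × κ) q →ₗ[ℂ] ℂ)
    (O : LocalOrderParameter d κ q) : Prop :=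
  ∃ C η : ℝ, 0 < η ∧ ∀ (L : ℕ) [NeZero L] (x : TorusSite d L),
    ‖connectedCorr (ω L) O 0 x‖ ≤ C * ((torusNorm x : ℝ) + 1) ^ (-η)

/-! ### Spin liquids -/

/-- **Quantum spin liquid — H21 working definition** (no canonical definition in print;
Savary–Balents, Rep. Prog. Phys. 80 (2017) §2; Knolle–Moessner, Ann. Rev. CMP 10 (2019)).
For spin `n/2` on the decorated tori `(ℤ/Lℤ)^d × κ`, a state family `ω` with Hamiltonians `H`
is a spin liquid iff
(1) *setting clause* (hubbard.S24, Hastings 2004): half-odd-integer spin per unit cell,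
`Odd (card κ · n)`;
(2) no long-range order for any local order parameter (`HasNoLongRangeOrder`);
(3) `ω` is translation- and `SU(2)`-symmetric (`IsSymmetricFamily`; point group not required);
(4) either `H` is in a gapped topological phase with `m ≥ 2` ground states
(`IsGappedTopologicalPhase`) or every local order parameter has algebraically decaying
correlations (`HasAlgebraicDecay`). [cite: Hastings2004] -/
def IsSpinLiquid (n : ℕ) (ω : ∀ L, Op (TorusSite d L × κ) (n + 1) →ₗ[ℂ] ℂ)
    (H : ∀ L, Op (TorusSite d L × κ) (n + 1)) : Prop :=
  Odd (Fintype.card κ * n) ∧ (∀ O, HasNoLongRangeOrder ω O) ∧ IsSymmetricFamily ω ∧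
    ((∃ m, 2 ≤ m ∧ IsGappedTopologicalPhase H m) ∨ ∀ O, HasAlgebraicDecay ω O)

/-- **Gapped (topological, e.g. `ℤ₂`) spin liquid — H21 working definition**: clauses (1)–(3)
of `IsSpinLiquid` together with a gapped topological phase with `m ≥ 2` locally
indistinguishable ground states. Savary–Balents (2017) §2, §4; Knolle–Moessner (2019) §2;
no canonical definition in print. [cite: SavaryBalents2017] -/
def IsGappedSpinLiquid (n : ℕ) (ω : ∀ L, Op (TorusSite d L × κ) (n + 1) →ₗ[ℂ] ℂ)
    (H : ∀ L, Op (TorusSite d L × κ) (n + 1)) : Prop :=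
  Odd (Fintype.card κ * n) ∧ (∀ O, HasNoLongRangeOrder ω O) ∧ IsSymmetricFamily ω ∧
    ∃ m, 2 ≤ m ∧ IsGappedTopologicalPhase H m

/-- **Gapless (algebraic) spin liquid — H21 working definition**: clauses (1)–(3) of
`IsSpinLiquid` together with algebraic decay of the correlations of every local order
parameter. Savary–Balents (2017) §2, §5; Knolle–Moessner (2019) §2; no canonical definition in
print. [cite: SavaryBalents2017] -/
def IsGaplessSpinLiquid (n : ℕ) (ω : ∀ L, Op (TorusSite d L × κ) (n + 1) →ₗ[ℂ] ℂ) : Prop :=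
  Odd (Fintype.card κ * n) ∧ (∀ O, HasNoLongRangeOrder ω O) ∧ IsSymmetricFamily ω ∧
    ∀ O, HasAlgebraicDecay ω O

/-- A gapped spin liquid is a spin liquid. H21 working definition. [folklore] -/
theorem IsGappedSpinLiquid.isSpinLiquid {n : ℕ} {ω : ∀ L, Op (TorusSite d L × κ) (n + 1) →ₗ[ℂ] ℂ}
    {H : ∀ L, Op (TorusSite d L × κ) (n + 1)} (h : IsGappedSpinLiquid n ω H) :
    IsSpinLiquid n ω H :=
  ⟨h.1, h.2.1, h.2.2.1, Or.inl h.2.2.2⟩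

/-- A gapless spin liquid is a spin liquid (for any Hamiltonian family). H21 working
definition. [folklore] -/
theorem IsGaplessSpinLiquid.isSpinLiquid {n : ℕ}
    {ω : ∀ L, Op (TorusSite d L × κ) (n + 1) →ₗ[ℂ] ℂ} (h : IsGaplessSpinLiquid n ω)
    (H : ∀ L, Op (TorusSite d L × κ) (n + 1)) : IsSpinLiquid n ω H :=
  ⟨h.1, h.2.1, h.2.2.1, Or.inr h.2.2.2⟩

/-- A spin liquid is a gapped or a gapless spin liquid (the two disjuncts of clause (4)).
H21 working definition. [folklore] -/
theorem isSpinLiquid_iff (n : ℕ) (ω : ∀ L, Op (TorusSite d L × κ) (n + 1) →ₗ[ℂ] ℂ)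
    (H : ∀ L, Op (TorusSite d L × κ) (n + 1)) :
    IsSpinLiquid n ω H ↔ IsGappedSpinLiquid n ω H ∨ IsGaplessSpinLiquid n ω := by
  refine ⟨fun h => ?_, fun h => h.elim IsGappedSpinLiquid.isSpinLiquid fun h' => h'.isSpinLiquid H⟩
  rcases h with ⟨h1, h2, h3, h4 | h4⟩
  · exact Or.inl ⟨h1, h2, h3, h4⟩
  · exact Or.inr ⟨h1, h2, h3, h4⟩

/-- A spin liquid has no long-range order in the §0 sense for any local order parameter
(`not_hasTorusLRO_of_hasNoLongRangeOrder`). Savary–Balents (2017) §2. [cite: SavaryBalents2017] -/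
def IsSpinLiquid.not_hasTorusLRO : Prop :=
  ∀ {n : ℕ} {ω : ∀ L, Op (TorusSite d L × κ) (n + 1) →ₗ[ℂ] ℂ} {H : ∀ L, Op (TorusSite d L × κ) (n + 1)} (h : IsSpinLiquid n ω H) (O : LocalOrderParameter d κ (n + 1)),
    ¬ HasTorusLRO (orderParamCorrFamily ω O)

/- interim proof relied on results that are now named facts (D-0014); demoted to a fact by the M5 import, proof preserved:
:=
  not_hasTorusLRO_of_hasNoLongRangeOrder (h.2.1 O)
-/

end Literature.MathematicalPhysics.QuantumLattice
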